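import Summits.CriticalPhenomena.Ising3DConformalLimit.Theses.MirrorHoelderCompactness
import HarnessLib

/-!
# `UniformRegularity` (item stmt-CriticalPhenomena-4658) ⟹ `NonSeparableModulus` (item stmt-CriticalPhenomena-6152)
(registered stub `stub_nonSeparableModulus_of_uniformRegularity`, glue "NS", of line `Sketch` of the
crux `ExistsScaleCovariantLimit`, item stmt-CriticalPhenomena-1981)

`NonSeparableModulus` (route `MirrorHoelderCompactness`, the "honestly open complement" of the
separable Hölder modulus) asks for asymptotic equicontinuity of the rescaled critical `ℤ³` Ising
correlators `F_n^δ = rescaledCorrelator (criticalCorr 3) ρ★ n δ`,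
`ρ★(δ) = ⟨σ₀ σ_{⌊δ⁻¹⌋ e₀}⟩_{β_c}^{-1/2}`, under ONE-point moves `x ↦ update x i y`, `‖y − x i‖ < η`,
at configurations `x` of a compact `K ⊆ NonCoincident 3 n` whose moving point is NOT `m`-separable
by any of the nine mirror normals, uniformly in `δ ∈ (0, δ₀)`.

Clause (b) of `UniformRegularity` (uniform equicontinuity on compacts of non-coincident
configurations, uniformly in `δ ∈ (0, δ₀)`) gives this for EVERY one-point move, separable or not,
so the separability hypothesis is simply ignored (and `m := 1`). The only point is that
`update x i y` need not lie in `K`: since `NonCoincident 3 n` is open (`isOpen_nonCoincident`) and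
`K` is compact, some closed thickening `K' := Metric.cthickening η₀ K`, `η₀ > 0`, is still
`⊆ NonCoincident 3 n` (`IsCompact.exists_cthickening_subset_open`) and is compact (the configuration
space is proper); clause (b) on `K'` yields `r, δ₀`, and `η := min η₀ r` works because
`dist (update x i y) x ≤ ‖y − x i‖` in the sup metric, so that `update x i y ∈ K'`, `x ∈ K ⊆ K'`
and `dist (update x i y) x < r`.

No lattice input beyond the hypothesis; no named unproved fact. References: folklore (compact sets
in open sets have compact closed thickenings; sup metric on a finite product). [folklore]
-/

noncomputable section

namespace Summit.CriticalPhenomena.Ising3DConformalLimit.Cruxes.ExistsScaleCovariantLimit.TwoHierarchies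

open Literature.Probability.LatticeModels Filter Set
open scoped Topology

/-- Moving one point of a configuration moves the configuration by at most the displacement, in
the sup distance of the product: `dist (update x i y) x ≤ ‖y − x i‖`. [folklore] -/
theorem dist_update_le_norm_sub {n : ℕ} (x : Fin n → EuclideanSpace ℝ (Fin 3)) (i : Fin n)
    (y : EuclideanSpace ℝ (Fin 3)) : dist (Function.update x i y) x ≤ ‖y - x i‖ := by
  refine (dist_pi_le_iff (norm_nonneg _)).2 fun j => ?_
  by_cases hj : j = i
  · subst hj
    simp [dist_eq_norm]
  · simp [Function.update_of_ne hj]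

/-- A compact set of non-coincident configurations has a compact closed thickening consisting of
non-coincident configurations (`NonCoincident 3 n` is open, the configuration space is proper).
[folklore] -/
theorem exists_compact_cthickening_subset_nonCoincident {n : ℕ}
    {K : Set (Fin n → EuclideanSpace ℝ (Fin 3))} (hKs : K ⊆ NonCoincident 3 n) (hK : IsCompact K) :
    ∃ η₀ : ℝ, 0 < η₀ ∧ IsCompact (Metric.cthickening η₀ K) ∧
      Metric.cthickening η₀ K ⊆ NonCoincident 3 n := by
  obtain ⟨η₀, hη₀, hsub⟩ := hK.exists_cthickening_subset_open (isOpen_nonCoincident 3 n) hKs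
  exact ⟨η₀, hη₀, hK.cthickening, hsub⟩

/-- **NS — item stmt-CriticalPhenomena-4658 `UniformRegularity` gives item stmt-CriticalPhenomena-6152
`NonSeparableModulus`**, regardless of separability: clause (b) of `UniformRegularity` (uniform
equicontinuity for `δ ∈ (0, δ₀)`) applied on a compact closed thickening `K' ⊇ K` inside
`NonCoincident 3 n` bounds `|F_n^δ(update x i y) − F_n^δ(x)|` by `ε` for every one-point move with
`‖y − x i‖ < min η₀ r`, since then `update x i y ∈ K'` and `dist (update x i y) x < r`. [folklore] -/
theorem stub_nonSeparableModulus_of_uniformRegularity :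
    Summit.CriticalPhenomena.Ising3DConformalLimit.Theses.MirrorHoelderCompactness.UniformRegularity →
    Summit.CriticalPhenomena.Ising3DConformalLimit.Theses.MirrorHoelderCompactness.NonSeparableModulus := by
  intro hUR n K hKs hK ε hε
  obtain ⟨η₀, hη₀, hK'c, hK's⟩ := exists_compact_cthickening_subset_nonCoincident hKs hK
  obtain ⟨r, δ₀, hr, hδ₀, hb⟩ := (hUR.1 n (Metric.cthickening η₀ K) hK's hK'c).2 ε hε
  refine ⟨1, min η₀ r, δ₀, one_pos, lt_min hη₀ hr, hδ₀, fun δ hδ x hx i y hy _ => ?_⟩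
  have hd : dist (Function.update x i y) x ≤ ‖y - x i‖ := dist_update_le_norm_sub x i y
  have hmem : Function.update x i y ∈ Metric.cthickening η₀ K :=
    Metric.mem_cthickening_of_dist_le _ x _ K hx (hd.trans (hy.le.trans (min_le_left _ _)))
  have hxK' : x ∈ Metric.cthickening η₀ K := Metric.self_subset_cthickening K hx
  exact hb δ hδ _ hmem x hxK' (hd.trans_lt (hy.trans_le (min_le_right _ _)))

end Summit.CriticalPhenomena.Ising3DConformalLimit.Cruxes.ExistsScaleCovariantLimit.TwoHierarchies

end
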